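import Summits.QuantumFields.BalabanUV.T4Continuum.Support.VariationalVectorGaugeSliceB5

/-!
# `BalabanUV.Beta.D1BFx.GaugeSandwichAbstract` — road «BF-x», binder row D1, slot (K), debt X₁ (`Δ_a·Ga = δ` on `ℤ⁴` for `Ga = Kinf`), brick
# **Q3c «GAUGE SANDWICH»** of `HOME/b2b-balaban-beta-d1-p2/X1-SPEC.md` v1 §1, PART 1 (ABSTRACT, an5 side): on every fine torus `T_η = Tor (fine n M)`,
# ANY Hermitian matrix `Ph` that KILLS `Δ(ker Q′)` and whose complement `1 − Ph` MAPS INTO `Δ(ker Q′)` agrees with an5's typed `PcT` ([B5] (1.26)∕(1.70))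
# on `1^⊥`; hence `∂·PcT·∂* = ∂·Ph·∂*` and `Δ_a = Δ − ∂·Ph·∂* + a·Q*Q` — the gauge sandwich of `B5DeltaA169.DeltaA` with `PcT` REPLACED by `Ph`

WHY (X1-SPEC v1 §1 bricks Q2∕Q3b∕Q3c∕Q4; journal CLAIM «X1-Q3c»).  Q4 periodises the `ℤ⁴` kernel `Δ^∞` of the (X₁a) operator and compares it with
`DeltaA_t` per volume; the two local terms are Q2's (`StencilDictionaryTorus.DeltaA_mulVec_castT` leaves `−n·dz (liftT0 (PcT *ᵥ (∂* g)))` verbatim); the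
gauge term needs `PcT` — Bałaban's MASSLESS form `Δ⁻¹Q′*(Q′Δ⁻²Q′*)⁻¹Q′Δ⁻¹` (`B5Value126`) — replaced by the periodisation `P̂` of the road's MASSIVE `ℤ⁴`
projector `Pker` (B9 (3.25) form, `RProjector`), which Q3b (`PeriodisedProjector`, owner) shows is symmetric, kills `Δ̂N(Q̂′)` and has `(1 − P̂)v ∈ Δ̂N(Q̂′)`
for EVERY `v`.  The two matrices are NOT equal (`range G′Q′* = range PcT ⊕ constants`), but `∂* = GradOpᴴ` maps into `1^⊥` and there they agree — by
UNIQUENESS OF THE ORTHOGONAL PROJECTION onto the slice subspace `Δ(ker Q′)`, which NE2's `VariationalVectorGaugeSliceB5.one_sub_PcT_eq_starProjection`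
(leaf V-GF file 3, IN TREE) already identifies with `1 − PcT` on `1^⊥`.  THIS FILE is that uniqueness argument with `P̂` ABSTRACTED to three laws
(H1) `Phᴴ = Ph`, (H2) `Q′f = 0 → Ph (Δ f) = 0`, (H3) `∀ b, ∃ f, Q′f = 0 ∧ b − Ph b = Δ f` (`Δ = LapS (fine n M) n`, `Q′ = QsOp n M`), so that it lands
BEFORE Q3b part 2 ∕ Q2 file 2 and PART 2 (`GaugeSandwich`) only instantiates `Ph := (periodise₂ s Pker).map ofReal` and discharges (H1)–(H3) by name.

CONTENT (all [folklore]; every `d`, every period vector `M`, level `n ≥ 1`; `Ph` and its three laws are BINDERS, nothing is asserted about `Pker` here).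
§1 `sum_divS_eq_zero` ∕ `sum_GradOp_conjTranspose_mulVec` (divergences are `⊥ 1`, any lattice factor `c`).  §2 under (H3): `one_sub_mem_slice` (`(1 − Ph)b ∈
Δ(ker Q′)` in NE2's `sliceSub 1 (kerAvgFlat)` currency); under (H1)+(H2): `star_mulVec_dotProduct_lapOp` (`Ph b ⊥ Δ(ker Q′)`); hence
**`one_sub_eq_starProjection`** (`Π_{Δ(ker Q′)} b = (1 − Ph) b` for EVERY `b`).  §3 **`one_sub_PcT_mulVec_eq`** ∕ **`PcT_mulVec_eq_of_laws`** (`PcT b = Ph b` for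
`b ⊥ 1`), **`gauge_sandwich_of_laws`** (`GradOp·PcT·GradOpᴴ = GradOp·Ph·GradOpᴴ`), **`DeltaA_eq_of_laws`** (`DeltaA n M a = Lap − GradOp·Ph·GradOpᴴ + a•(QvAdj·QvOp)`)
and `DeltaA_mulVec_of_laws` (an5's `DeltaA_mulVec` with `Ph`).  §4 non-vacuity (restricted): `PcT` satisfies (H1), (H2) and the (H3)-decomposition on `1^⊥` (`laws_PcT_of_orth`).

HONEST FRAMING (cell contract, verbatim): «discharging `BetaPertH` makes Bałaban's UV stability UNCONDITIONAL — a real constructive-QFT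
result; it is NOT the continuum limit and NOT the Clay problem.»  HONEST DEPENDENCY (verbatim): «continuum YM on T⁴ ⇐ BetaPertH ∧ nine
spine estimates (0/9 proved); BetaPertH ⇐ (D1) ∧ (D4) ∧ CAP+tail; G-an2-4 gates asym, D1 and NE2/3/4.»  [folklore] finite-dimensional linear algebra over
NE2's landed key lemma and an5's kernel-certified `PcT`∕`DeltaA` (USED BY NAME, nothing re-proved); no `Prop` is minted, nothing is cited, no wall binder is
instantiated; 0 sorry.  NOT D1, NOT BetaPertH, NOT summit progress.  ABSOLUTE RULE (cell, verbatim): «No internally-minted statement may enter as a cited fact.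
Every hypothesis is either kernel-proved in this package or a verbatim quotation of a PUBLISHED theorem with page reference. The manuscript(s) under audit are
NOT citable for their own disputed steps — they are the thing under adjudication; programme-internal (2001/route/tribunal) claims are never citable.»
Provenance: D1 formalisation swarm, unit `b2b-balaban-beta-d1-formalise-leaf-03` (gen 7), claim «X1-Q3c» part 1, 2026-08-20.
-/

noncomputable section

namespace Summit.QuantumFields.BalabanUV.Beta.D1BFx.GaugeSandwichAbstract

open Finset WithLp Matrix
open scoped InnerProductSpace ComplexConjugate Matrix
open Literature.MathematicalPhysics.QuantumFieldTheory.Balaban1983to89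
open Literature.MathematicalPhysics.QuantumFieldTheory.Balaban1983to89.B5Prop11Plancherel (Tor fine unitVec)
open Literature.MathematicalPhysics.QuantumFieldTheory.Balaban1983to89.B5Block118 (QvOp QsOp)
open Literature.MathematicalPhysics.QuantumFieldTheory.Balaban1983to89.B5Action121 (LapS GradOp divS divS_apply GradOp_conjTranspose_mulVec_eq)
open Literature.MathematicalPhysics.QuantumFieldTheory.Balaban1983to89.B5Value126 (PcT PcT_mulVec PcT_conjTranspose ext_of_mulVec)
open Literature.MathematicalPhysics.QuantumFieldTheory.Balaban1983to89.B5Prop11Lower (Lap)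
open Literature.MathematicalPhysics.QuantumFieldTheory.Balaban1983to89.B5DeltaA169 (QvAdj DeltaA QvAdj_mulVec)
open Summit.QuantumFields.BalabanUV.T4Continuum.VariationalVectorGaugeSlice (lapOp sliceSub mem_sliceSub)
open Summit.QuantumFields.BalabanUV.T4Continuum.VariationalVectorGaugeSliceFlat (kerAvgFlat)
open Summit.QuantumFields.BalabanUV.T4Continuum.VariationalVectorGaugeSliceB5
  (flatR mem_kerAvgFlat_iff sum_eq_zero_of_QsOp LapS_mulVec_eq_lapOp PcT_LapS_of_ker one_sub_PcT_mem one_sub_PcT_eq_starProjection)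

variable {d : ℕ} (n : ℕ) [NeZero n] (M : Fin d → ℕ) [hM : ∀ μ, NeZero (M μ)]

/-! ## §1 Divergences are orthogonal to constants -/

omit hM in
/-- [folklore] `Σ_x (∂*A)(x) = 0` on any torus `Tor N`, any lattice factor `c` (every bond enters twice with opposite signs). -/
theorem sum_divS_eq_zero {N : Fin d → ℕ} [∀ μ, NeZero (N μ)] (c : ℂ) (A : Tor N × Fin d → ℂ) : ∑ x, divS N c A x = 0 := by
  simp only [divS_apply]
  rw [Finset.sum_comm]
  refine Finset.sum_eq_zero fun μ _ => ?_
  rw [← Finset.mul_sum, Finset.sum_sub_distrib, sub_eq_zero.mpr, mul_zero]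
  exact (Equiv.subRight (unitVec N μ)).sum_comp (fun x => A (x, μ))

omit hM in
/-- [folklore] `(GradOp)ᴴ v ⊥ 1`: the adjoint gradient maps into the complement of the constants. -/
theorem sum_GradOp_conjTranspose_mulVec {N : Fin d → ℕ} [∀ μ, NeZero (N μ)] (c : ℂ) (A : Tor N × Fin d → ℂ) :
    ∑ x, ((GradOp N c)ᴴ *ᵥ A) x = 0 := by
  rw [GradOp_conjTranspose_mulVec_eq]
  exact sum_divS_eq_zero c A

/-! ## §2 An abstract projector with the three laws is `1 − Π_{Δ(ker Q′)}` -/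

section Laws

variable {Ph : Matrix (Tor (fine n M)) (Tor (fine n M)) ℂ}

/-- [folklore] (H3) ⟹ `(1 − Ph) b ∈ Δ(ker Q′)` (NE2's slice-subspace currency: `lapOp 1 (kerAvgFlat)`), for EVERY `b`. -/
theorem one_sub_mem_slice
    (H3 : ∀ b, ∃ f, QsOp n M *ᵥ f = 0 ∧ b - Ph *ᵥ b = LapS (fine n M) (n : ℂ) *ᵥ f) (b : Tor (fine n M) → ℂ) :
    (1 - Ph) *ᵥ b ∈ (kerAvgFlat n M).map (lapOp (fine n M) (flatR n M)) := by
  obtain ⟨f, hf, hb⟩ := H3 b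
  refine Submodule.mem_map.mpr ⟨((n : ℂ) ^ 2) • f, ?_, ?_⟩
  · rw [mem_kerAvgFlat_iff, Matrix.mulVec_smul, hf, smul_zero]
  · rw [map_smul, Matrix.sub_mulVec, Matrix.one_mulVec, hb, LapS_mulVec_eq_lapOp]
    funext x
    simp only [Pi.smul_apply, smul_eq_mul]

/-- [folklore] (H1)+(H2) ⟹ `Ph b ⊥ Δ(ker Q′)`: `star (Ph b) ⬝ᵥ (lapOp 1 f) = 0` for `Q′f = 0`. -/
theorem star_mulVec_dotProduct_lapOp (H1 : Phᴴ = Ph)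
    (H2 : ∀ f, QsOp n M *ᵥ f = 0 → Ph *ᵥ (LapS (fine n M) (n : ℂ) *ᵥ f) = 0)
    {f : Tor (fine n M) → ℂ} (hf : QsOp n M *ᵥ f = 0) (b : Tor (fine n M) → ℂ) :
    star (Ph *ᵥ b) ⬝ᵥ lapOp (fine n M) (flatR n M) f = 0 := by
  have hn2 : ((n : ℂ) ^ 2) ≠ 0 := pow_ne_zero _ (by exact_mod_cast NeZero.ne n)
  have hlap : lapOp (fine n M) (flatR n M) f = ((n : ℂ) ^ 2)⁻¹ • (LapS (fine n M) (n : ℂ) *ᵥ f) := by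
    rw [LapS_mulVec_eq_lapOp]; funext x; simp [hn2]
  rw [hlap, dotProduct_smul, Matrix.star_mulVec, H1, ← dotProduct_mulVec, H2 f hf, dotProduct_zero, smul_zero]

/-- [folklore] **THE ABSTRACT PROJECTOR IS THE ORTHOGONAL PROJECTION**: under (H1)–(H3), `Π_{Δ(ker Q′)} b = (1 − Ph) b` for EVERY `b`
(membership by (H3), orthogonality of `b − (1 − Ph)b = Ph b` by (H1)+(H2); `Submodule.eq_starProjection_of_mem_of_inner_eq_zero`). -/
theorem one_sub_eq_starProjection (H1 : Phᴴ = Ph)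
    (H2 : ∀ f, QsOp n M *ᵥ f = 0 → Ph *ᵥ (LapS (fine n M) (n : ℂ) *ᵥ f) = 0)
    (H3 : ∀ b, ∃ f, QsOp n M *ᵥ f = 0 ∧ b - Ph *ᵥ b = LapS (fine n M) (n : ℂ) *ᵥ f) (b : Tor (fine n M) → ℂ) :
    (sliceSub (fine n M) (flatR n M) (kerAvgFlat n M)).starProjection (toLp 2 b) = toLp 2 ((1 - Ph) *ᵥ b) := by
  refine Submodule.eq_starProjection_of_mem_of_inner_eq_zero ?_ ?_
  · exact (mem_sliceSub (fine n M) _).mpr (one_sub_mem_slice n M H3 b)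
  · intro w hw
    obtain ⟨f, hfK, hf⟩ := Submodule.mem_map.mp ((mem_sliceSub (fine n M) w).mp hw)
    have hw' : w = toLp 2 (lapOp (fine n M) (flatR n M) f) := by rw [hf, toLp_ofLp]
    have hsub : toLp 2 b - toLp 2 ((1 - Ph) *ᵥ b) = toLp (2 : ENNReal) (Ph *ᵥ b) := by
      rw [← toLp_sub, Matrix.sub_mulVec, Matrix.one_mulVec, sub_sub_cancel]
    rw [hsub, hw', EuclideanSpace.inner_toLp_toLp, dotProduct_comm]
    exact star_mulVec_dotProduct_lapOp n M H1 H2 ((mem_kerAvgFlat_iff n M f).mp hfK) b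

/-! ## §3 Agreement with `PcT` on `1^⊥`, the gauge sandwich, `Δ_a` with `Ph` -/

/-- [folklore] **ON `1^⊥`, `1 − PcT = 1 − Ph`**: two vectors that are both the orthogonal projection of `b` onto `Δ(ker Q′)` coincide
(NE2's `one_sub_PcT_eq_starProjection` for `b ⊥ 1` + `one_sub_eq_starProjection`). -/
theorem one_sub_PcT_mulVec_eq (H1 : Phᴴ = Ph)
    (H2 : ∀ f, QsOp n M *ᵥ f = 0 → Ph *ᵥ (LapS (fine n M) (n : ℂ) *ᵥ f) = 0)
    (H3 : ∀ b, ∃ f, QsOp n M *ᵥ f = 0 ∧ b - Ph *ᵥ b = LapS (fine n M) (n : ℂ) *ᵥ f)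
    {b : Tor (fine n M) → ℂ} (hb : ∑ x, b x = 0) :
    (1 - PcT n M (n : ℂ)) *ᵥ b = (1 - Ph) *ᵥ b :=
  WithLp.toLp_injective 2 ((one_sub_PcT_eq_starProjection n M hb).symm.trans (one_sub_eq_starProjection n M H1 H2 H3 b))

/-- [folklore] **`PcT b = Ph b` for `b ⊥ 1`.** -/
theorem PcT_mulVec_eq_of_laws (H1 : Phᴴ = Ph)
    (H2 : ∀ f, QsOp n M *ᵥ f = 0 → Ph *ᵥ (LapS (fine n M) (n : ℂ) *ᵥ f) = 0)
    (H3 : ∀ b, ∃ f, QsOp n M *ᵥ f = 0 ∧ b - Ph *ᵥ b = LapS (fine n M) (n : ℂ) *ᵥ f)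
    {b : Tor (fine n M) → ℂ} (hb : ∑ x, b x = 0) :
    PcT n M (n : ℂ) *ᵥ b = Ph *ᵥ b := by
  have h := one_sub_PcT_mulVec_eq n M H1 H2 H3 hb
  simp only [Matrix.sub_mulVec, Matrix.one_mulVec] at h
  exact sub_right_injective h

/-- [folklore] **THE GAUGE SANDWICH**: `GradOp·PcT·GradOpᴴ = GradOp·Ph·GradOpᴴ` (`GradOpᴴ v ⊥ 1` for every `v`, then `PcT = Ph` there). -/
theorem gauge_sandwich_of_laws (H1 : Phᴴ = Ph)
    (H2 : ∀ f, QsOp n M *ᵥ f = 0 → Ph *ᵥ (LapS (fine n M) (n : ℂ) *ᵥ f) = 0)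
    (H3 : ∀ b, ∃ f, QsOp n M *ᵥ f = 0 ∧ b - Ph *ᵥ b = LapS (fine n M) (n : ℂ) *ᵥ f) :
    GradOp (fine n M) (n : ℂ) * PcT n M (n : ℂ) * (GradOp (fine n M) (n : ℂ))ᴴ
      = GradOp (fine n M) (n : ℂ) * Ph * (GradOp (fine n M) (n : ℂ))ᴴ :=
  ext_of_mulVec fun v => by
    rw [← Matrix.mulVec_mulVec, ← Matrix.mulVec_mulVec, ← Matrix.mulVec_mulVec, ← Matrix.mulVec_mulVec,
      PcT_mulVec_eq_of_laws n M H1 H2 H3 (sum_GradOp_conjTranspose_mulVec (n : ℂ) v)]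

/-- [folklore] **`Δ_a` WITH THE ABSTRACT PROJECTOR**: `DeltaA n M a = Lap − GradOp·Ph·GradOpᴴ + a•(QvAdj·QvOp)` — an5's (1.69)∕(1.73) operator with
`PcT` replaced by any `Ph` obeying (H1)–(H3). -/
theorem DeltaA_eq_of_laws (H1 : Phᴴ = Ph)
    (H2 : ∀ f, QsOp n M *ᵥ f = 0 → Ph *ᵥ (LapS (fine n M) (n : ℂ) *ᵥ f) = 0)
    (H3 : ∀ b, ∃ f, QsOp n M *ᵥ f = 0 ∧ b - Ph *ᵥ b = LapS (fine n M) (n : ℂ) *ᵥ f) (a : ℝ) :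
    DeltaA n M a = Lap n M - GradOp (fine n M) (n : ℂ) * Ph * (GradOp (fine n M) (n : ℂ))ᴴ + (a : ℂ) • (QvAdj n M * QvOp n M) := by
  rw [DeltaA, gauge_sandwich_of_laws n M H1 H2 H3]

/-- [folklore] … applied to a vector: `Δ_a A = ΔA − ∂(Ph(∂*A)) + (a n^d)•Qᴴ(QA)` (an5's `DeltaA_mulVec` with `Ph`). -/
theorem DeltaA_mulVec_of_laws (H1 : Phᴴ = Ph)
    (H2 : ∀ f, QsOp n M *ᵥ f = 0 → Ph *ᵥ (LapS (fine n M) (n : ℂ) *ᵥ f) = 0)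
    (H3 : ∀ b, ∃ f, QsOp n M *ᵥ f = 0 ∧ b - Ph *ᵥ b = LapS (fine n M) (n : ℂ) *ᵥ f) (a : ℝ)
    (A : Tor (fine n M) × Fin d → ℂ) :
    DeltaA n M a *ᵥ A
      = Lap n M *ᵥ A - GradOp (fine n M) (n : ℂ) *ᵥ (Ph *ᵥ ((GradOp (fine n M) (n : ℂ))ᴴ *ᵥ A))
        + ((a : ℂ) * (n : ℂ) ^ d) • ((QvOp n M)ᴴ *ᵥ (QvOp n M *ᵥ A)) := by
  rw [DeltaA_eq_of_laws n M H1 H2 H3 a, Matrix.add_mulVec, Matrix.sub_mulVec, Matrix.smul_mulVec,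
    ← Matrix.mulVec_mulVec, ← Matrix.mulVec_mulVec, ← Matrix.mulVec_mulVec, QvAdj_mulVec, smul_smul]

/-- [folklore] The pointwise reading used against Q2 file 2: for every `g`, `PcT (∂* g) = Ph (∂* g)`. -/
theorem PcT_GradOpH_eq_of_laws (H1 : Phᴴ = Ph)
    (H2 : ∀ f, QsOp n M *ᵥ f = 0 → Ph *ᵥ (LapS (fine n M) (n : ℂ) *ᵥ f) = 0)
    (H3 : ∀ b, ∃ f, QsOp n M *ᵥ f = 0 ∧ b - Ph *ᵥ b = LapS (fine n M) (n : ℂ) *ᵥ f)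
    (g : Tor (fine n M) × Fin d → ℂ) :
    PcT n M (n : ℂ) *ᵥ ((GradOp (fine n M) (n : ℂ))ᴴ *ᵥ g) = Ph *ᵥ ((GradOp (fine n M) (n : ℂ))ᴴ *ᵥ g) :=
  PcT_mulVec_eq_of_laws n M H1 H2 H3 (sum_GradOp_conjTranspose_mulVec (n : ℂ) g)

end Laws

/-! ## §4 Non-vacuity: `PcT` itself obeys the three laws -/

/-- [folklore] NON-VACUITY, RESTRICTED FORM: `Ph := PcT n M n` satisfies (H1), (H2) (= NE2's `PcT_LapS_of_ker`) and the (H3)-decomposition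
for every `b ⊥ 1` (NE2's `one_sub_PcT_mem`).  (For ALL `b`, (H3) FAILS for `PcT` — `1 − PcT` fixes the constants — which is exactly why the
massive projector `P̂` of Q3b, for which (H3) holds unrestrictedly, is a different matrix agreeing with `PcT` only on `1^⊥`.) -/
theorem laws_PcT_of_orth {b : Tor (fine n M) → ℂ} (hb : ∑ x, b x = 0) :
    (PcT n M (n : ℂ))ᴴ = PcT n M (n : ℂ)
      ∧ (∀ f, QsOp n M *ᵥ f = 0 → PcT n M (n : ℂ) *ᵥ (LapS (fine n M) (n : ℂ) *ᵥ f) = 0)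
      ∧ ∃ f, QsOp n M *ᵥ f = 0 ∧ b - PcT n M (n : ℂ) *ᵥ b = LapS (fine n M) (n : ℂ) *ᵥ f := by
  refine ⟨PcT_conjTranspose n M (n : ℂ), fun f hf => PcT_LapS_of_ker n M hf, ?_⟩
  obtain ⟨f, hfK, hf⟩ := Submodule.mem_map.mp (one_sub_PcT_mem n M hb)
  have hn2 : ((n : ℂ) ^ 2) ≠ 0 := pow_ne_zero _ (by exact_mod_cast NeZero.ne n)
  refine ⟨((n : ℂ) ^ 2)⁻¹ • f, ?_, ?_⟩
  · rw [Matrix.mulVec_smul, (mem_kerAvgFlat_iff n M f).mp hfK, smul_zero]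
  · rw [Matrix.mulVec_smul, LapS_mulVec_eq_lapOp]
    have e : b - PcT n M (n : ℂ) *ᵥ b = (1 - PcT n M (n : ℂ)) *ᵥ b := by
      rw [Matrix.sub_mulVec, Matrix.one_mulVec]
    rw [e, ← hf]
    funext x
    simp only [Pi.smul_apply, smul_eq_mul]
    rw [← mul_assoc, inv_mul_cancel₀ hn2, one_mul]

end Summit.QuantumFields.BalabanUV.Beta.D1BFx.GaugeSandwichAbstract

end
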